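import Literature.NumberTheory.GaloisRepresentations.InertiaLift
import Literature.NumberTheory.GaloisRepresentations.IntegralGaloisAction
import Mathlib.NumberTheory.RamificationInertia.Galois
import Mathlib.NumberTheory.RamificationInertia.Valuation
import Mathlib.NumberTheory.NumberField.Basic
import Mathlib.FieldTheory.Galois.Infinite
import Mathlib.RingTheory.RootsOfUnity.PrimitiveRoots
import Mathlib.RingTheory.Ideal.Quotient.HasFiniteQuotients
import Mathlib.RingTheory.Flat.TorsionFree
import HarnessLib

/-!
# Unramified Kummer extensions: `k(a^{1/d})/k` unramified at `w` forces `d ∣ ord_w(a)`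

Silverman, *The Arithmetic of Elliptic Curves*, 2nd ed., proof of Prop. VIII.1.6: for a
number field `k ⊇ μ_d` and `a ∈ k^*`, *"`k_v(a^{1/d})/k_v` is unramified if and only if
`ord_v(a) ≡ 0 (mod d)`"* (for `v ∤ d`); this is the step that puts the Kummer generators of the
maximal abelian extension of exponent `d` unramified outside `S` into the finite group
`T_S = k(S, d)`. This file proves the direction used there,

  unramified at `w` ⟹ `d ∣ ord_w(a)`,

which holds at every finite place `w` (no hypothesis `w ∤ d`), with "unramified" expressed through
inertia subgroups of the (infinite) Galois group, as in the definition of unramified cohomology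
classes (Silverman VIII.§2, X.§4): for a Galois extension `Ω/k` containing a `d`-th root `α` of
`a`, and a prime `𝔓` of the integral closure `B` of `𝓞 k` in `Ω` above `w`, *if every element of
the inertia group `I_𝔓 ≤ Gal(Ω/k)` fixes `α`, then `d ∣ ord_w(a)`*
(`Literature.NumberTheory.EllipticCurves.dvd_log_valuation_of_inertia_fixes_root`, stated for a general Galois pair `(k, Ω)` and the
group `Ω ≃ₐ[k] Ω`: the finiteness of `H¹(G_K, M; S)` (Lemma X.4.3) needs it for `Ω = K̄` over the
*finite extensions* `k = K' ⊆ K̄` of the ground field `K`, where `Gal(K̄/K') ≤ Gal(K̄/K)` is not an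
absolute Galois group in Mathlib's sense). The specialisation to `k` itself with the tree's
`\bar ℤ_k = Literature.absIntegers (𝓞 k) k`, `𝔓 ∈ w.primesAbove` and `I_𝔓 ≤ Field.absoluteGaloisGroup k`
(the convention of `IntegralGaloisAction`, `Literature.NumberTheory.EllipticCurves.h1Unramified`, `Literature.NumberTheory.EllipticCurves.unramifiedHoms`) is
`Literature.NumberTheory.EllipticCurves.dvd_log_valuation_of_absoluteGaloisGroup_inertia_fixes_root`; since
`Field.absoluteGaloisGroup` and the `𝓞 k`-algebra structure of `K̄` behind `absIntegers` are only
*definitionally* those of the general statement, it is obtained by an `@`-application.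

Proof. `L = k(α) ⊆ Ω` is finite Galois over `k` (all conjugates `ζⁱ α` of `α` lie in `L`);
`G = Gal(L/k)` acts on `𝓞 L` with invariants `𝓞 k` (`IsGaloisGroup.of_isFractionRing`). Let
`P = 𝔓 ∩ 𝓞 L`. An element of the inertia group `I_P(G)` lifts, by the profinite inertia lifting
lemma `Literature.NumberTheory.GaloisRepresentations.exists_mul_mul_mem_inertia` (Serre, *Local Fields*, I §7 Prop. 22(b)) applied to
`N = Gal(Ω/L)`, to an element of `I_𝔓 ≤ Gal(Ω/k)` with the same action on `L`; by hypothesis it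
fixes `α`, hence all of `L = k(α)`: so `I_P(G) = 1`. By Mathlib's
`Ideal.card_inertia_eq_ramificationIdxIn`, `e(P ∣ w) = #I_P(G) = 1`, and then
`ord_w(a) = e · ord_w(a) = ord_P(a) = ord_P(α^d) = d · ord_P(α)`
(`IsDedekindDomain.HeightOneSpectrum.valuation_liesOver`).

## Mathlib reuse

`IntermediateField.adjoin`, `IntermediateField.normal_iff_forall_map_le'`,
`IsPrimitiveRoot.eq_pow_of_pow_eq_one`, `AlgEquiv.liftNormal(_commutes)`,
`InfiniteGalois.fixedField_fixingSubgroup`, `IntermediateField.fixingSubgroup_isClosed`,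
`IsGaloisGroup.of_isFractionRing`, `IsIntegralClosure.finite`,
`Ideal.card_inertia_eq_ramificationIdxIn`, `Ideal.ramificationIdxIn_eq_ramificationIdx`,
`Ideal.ramificationIdx'_eq_ramificationIdx`, `IsDedekindDomain.HeightOneSpectrum.valuation_liesOver`,
`WithZero.log_pow`; from `Literature`: `Literature.NumberTheory.GaloisRepresentations.exists_mul_mul_mem_inertia` (`InertiaLift`),
`Literature.NumberTheory.GaloisRepresentations.stabilizer_integralClosure_isOpen` (`IntegralGaloisAction`).
-/

noncomputable section

open scoped Pointwise IntermediateField NumberField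

open NumberField IsDedekindDomain IntermediateField

universe u

namespace Literature.NumberTheory.EllipticCurves

section Conjugates

variable {k : Type u} [Field k] {Ω : Type u} [Field Ω] [Algebra k Ω]

/-- If `k` contains a primitive `d`-th root of unity `ζ` and `α^d = a ∈ k`, then every
`k`-automorphism of `Ω ∋ α` sends `α` to some `ζⁱ α`. Silverman, *AEC*, VIII.§1 (Kummer pairing,
proof of Prop. 1.2/Thm. 1.1: "the Galois conjugates of `a^{1/d}` are `ζ a^{1/d}`"). [folklore] -/
theorem exists_algEquiv_apply_eq_pow_mul {d : ℕ} (hd : 0 < d) {ζ : k} (hζ : IsPrimitiveRoot ζ d)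
    {a : k} (ha : a ≠ 0) {α : Ω} (hα : α ^ d = algebraMap k Ω a) (σ : Ω ≃ₐ[k] Ω) :
    ∃ i < d, σ α = algebraMap k Ω ζ ^ i * α := by
  haveI : NeZero d := ⟨hd.ne'⟩
  have hα0 : α ≠ 0 := by
    rintro rfl
    rw [zero_pow hd.ne', eq_comm, map_eq_zero] at hα
    exact ha hα
  have hζ' : IsPrimitiveRoot (algebraMap k Ω ζ) d :=
    hζ.map_of_injective (algebraMap k Ω).injective
  have h1 : (σ α / α) ^ d = 1 := by
    rw [div_pow, ← map_pow, hα, AlgEquiv.commutes, div_self]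
    rw [← hα]
    exact pow_ne_zero _ hα0
  obtain ⟨i, hi, hζi⟩ := hζ'.eq_pow_of_pow_eq_one h1
  exact ⟨i, hi, by rw [hζi, div_mul_cancel₀ _ hα0]⟩

/-- With `μ_d ⊆ k` and `α^d = a ∈ k^*`, the field `k(α) ⊆ Ω` is normal over `k` (it contains all
the conjugates `ζⁱ α` of `α`); `Ω/k` normal. Silverman, *AEC*, VIII.§1 (proof of Prop. 1.2(d)/1.5:
`K(Q)`, resp. `K(a^{1/m})`, is Galois over `K` when `E[m] ⊆ E(K)`, resp. `μ_m ⊆ K`). [folklore] -/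
theorem normal_adjoin_root [Normal k Ω] {d : ℕ} (hd : 0 < d) {ζ : k} (hζ : IsPrimitiveRoot ζ d)
    {a : k} (ha : a ≠ 0) {α : Ω} (hα : α ^ d = algebraMap k Ω a) : Normal k k⟮α⟯ := by
  rw [IntermediateField.normal_iff_forall_map_le']
  intro σ
  rw [IntermediateField.adjoin_map, Set.image_singleton, IntermediateField.adjoin_simple_le_iff]
  change σ α ∈ k⟮α⟯
  obtain ⟨i, -, hi⟩ := exists_algEquiv_apply_eq_pow_mul hd hζ ha hα σ
  rw [hi, ← map_pow]
  exact mul_mem (IntermediateField.algebraMap_mem _ _) (IntermediateField.mem_adjoin_simple_self k α)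

/-- A `k`-automorphism of `k(α)` fixing `α` is the identity. [folklore] -/
theorem algEquiv_adjoin_eq_one_of_apply_eq {α : Ω} (g : k⟮α⟯ ≃ₐ[k] k⟮α⟯)
    (hg : g (AdjoinSimple.gen k α) = AdjoinSimple.gen k α) : g = 1 := by
  have key : ∀ x : k⟮α⟯, g x = x := by
    intro x
    have hx : (x : Ω) ∈ k⟮α⟯ := x.2
    -- the elements of `k⟮α⟯` on which `g` (transported to `Ω`) is the identity form an
    -- intermediate field containing `α`
    let F : IntermediateField k Ω :=
      { carrier := {y | ∃ hy : y ∈ k⟮α⟯, (g ⟨y, hy⟩ : Ω) = y}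
        mul_mem' := by
          rintro y z ⟨hy, hgy⟩ ⟨hz, hgz⟩
          refine ⟨mul_mem hy hz, ?_⟩
          have : (⟨y * z, mul_mem hy hz⟩ : k⟮α⟯) = ⟨y, hy⟩ * ⟨z, hz⟩ := rfl
          rw [this, map_mul]
          simp [hgy, hgz]
        one_mem' := ⟨one_mem _, by
          have : (⟨1, one_mem _⟩ : k⟮α⟯) = 1 := rfl
          rw [this, map_one]
          rfl⟩
        add_mem' := by
          rintro y z ⟨hy, hgy⟩ ⟨hz, hgz⟩
          refine ⟨add_mem hy hz, ?_⟩
          have : (⟨y + z, add_mem hy hz⟩ : k⟮α⟯) = ⟨y, hy⟩ + ⟨z, hz⟩ := rfl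
          rw [this, map_add]
          simp [hgy, hgz]
        zero_mem' := ⟨zero_mem _, by
          have : (⟨0, zero_mem _⟩ : k⟮α⟯) = 0 := rfl
          rw [this, map_zero]
          rfl⟩
        algebraMap_mem' := fun r ↦ ⟨IntermediateField.algebraMap_mem _ r, by
          have : (⟨algebraMap k Ω r, IntermediateField.algebraMap_mem _ r⟩ : k⟮α⟯) =
            algebraMap k k⟮α⟯ r := rfl
          rw [this, AlgEquiv.commutes]
          rfl⟩
        inv_mem' := by
          rintro y ⟨hy, hgy⟩
          refine ⟨inv_mem hy, ?_⟩
          have : (⟨y⁻¹, inv_mem hy⟩ : k⟮α⟯) = (⟨y, hy⟩ : k⟮α⟯)⁻¹ := rfl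
          rw [this, map_inv₀]
          simp [hgy] }
    have hF : k⟮α⟯ ≤ F := by
      rw [IntermediateField.adjoin_simple_le_iff]
      exact ⟨IntermediateField.mem_adjoin_simple_self k α, congrArg Subtype.val hg⟩
    obtain ⟨hx', hgx⟩ := hF hx
    exact Subtype.ext hgx
  ext x
  exact congrArg Subtype.val (key x)

end Conjugates

section IntegersMap

variable {k : Type u} [Field k] {Ω : Type u} [Field Ω] [Algebra k Ω]

/-- The inclusion `𝓞 L → B` of the ring of integers of a subextension `L ⊆ Ω` of `k` into the
integral closure `B` of `𝓞 k` in `Ω`. On underlying elements it is Mathlib's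
`NumberField.RingOfIntegers.mapRingHom (algebraMap L Ω)` (which lands in `𝓞 Ω`) and it extends
`IntermediateField.integralClosureInclusion` of `RamificationFiltration` (whose domain is
`integralClosure R L` rather than `𝓞 L`). [folklore] -/
def ringOfIntegersToIntegralClosure (L : IntermediateField k Ω) :
    𝓞 L →+* integralClosure (𝓞 k) Ω :=
  ((algebraMap L Ω).comp (algebraMap (𝓞 L) L)).codRestrict (integralClosure (𝓞 k) Ω) fun x ↦ by
    rw [mem_integralClosure_iff]
    have hx : IsIntegral ℤ (algebraMap L Ω (algebraMap (𝓞 L) L x)) :=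
      (RingOfIntegers.isIntegral_coe x).map (IsScalarTower.toAlgHom ℤ L Ω)
    exact hx.tower_top

/-- Underlying element of `ringOfIntegersToIntegralClosure`. [folklore] -/
@[simp]
theorem coe_ringOfIntegersToIntegralClosure (L : IntermediateField k Ω) (x : 𝓞 L) :
    (ringOfIntegersToIntegralClosure L x : Ω) = ((x : L) : Ω) :=
  rfl

/-- `ringOfIntegersToIntegralClosure` is compatible with the structure maps from `𝓞 k`. [folklore] -/
theorem ringOfIntegersToIntegralClosure_comp_algebraMap (L : IntermediateField k Ω) :
    (ringOfIntegersToIntegralClosure L).comp (algebraMap (𝓞 k) (𝓞 L)) =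
      algebraMap (𝓞 k) (integralClosure (𝓞 k) Ω) := by
  ext r
  change ((algebraMap (𝓞 k) (𝓞 L) r : L) : Ω) = algebraMap (𝓞 k) Ω r
  rw [IsScalarTower.algebraMap_apply (𝓞 k) k Ω]
  exact (IsScalarTower.algebraMap_apply k L Ω (r : k)).symm

/-- `ringOfIntegersToIntegralClosure` is injective. [folklore] -/
theorem ringOfIntegersToIntegralClosure_injective (L : IntermediateField k Ω) :
    Function.Injective (ringOfIntegersToIntegralClosure L) := by
  intro x y hxy
  have h := congrArg (fun z : integralClosure (𝓞 k) Ω ↦ (z : Ω)) hxy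
  simp only [coe_ringOfIntegersToIntegralClosure] at h
  exact RingOfIntegers.ext (Subtype.val_injective h)

end IntegersMap

section NumberField

variable {k : Type u} [Field k] [NumberField k] {Ω : Type u} [Field Ω] [Algebra k Ω] [IsGalois k Ω]

/-- **Unramified Kummer extensions have `d ∣ ord_w(a)`.** Let `k` be a number field containing a
primitive `d`-th root of unity `ζ`, let `Ω/k` be Galois, `a ∈ k^*` and `α ∈ Ω` with `α^d = a`.
Let `w` be a finite place of `k` and `𝔓` a prime of the integral closure `B` of `𝓞 k` in `Ω`
above `w`. If every element of the inertia group `I_𝔓 ≤ Gal(Ω/k)` fixes `α` (i.e. `k(α)/k` is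
unramified at the place of `k(α)` below `𝔓`), then `d ∣ ord_w(a)`
(`ord_w = WithZero.log ∘ w.valuation k`, the normalised additive valuation up to Mathlib's sign
convention). Silverman, *AEC*, proof of Prop. VIII.1.6: *"`K_v(a^{1/m})/K_v` is unramified if and
only if `ord_v(a) ≡ 0 (mod m)`"* — the "only if" direction, which holds at every `v`.
[cite: SilvermanAEC2009, Prop. VIII.1.6 (proof)] -/
theorem dvd_log_valuation_of_inertia_fixes_root {d : ℕ} (hd : 0 < d) {ζ : k}
    (hζ : IsPrimitiveRoot ζ d) {a : k} (ha : a ≠ 0) {α : Ω} (hα : α ^ d = algebraMap k Ω a)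
    (w : HeightOneSpectrum (𝓞 k)) (𝔓 : Ideal (integralClosure (𝓞 k) Ω)) [𝔓.IsPrime]
    [𝔓.LiesOver w.asIdeal]
    (hI : ∀ σ : Ω ≃ₐ[k] Ω, σ ∈ 𝔓.inertia (Ω ≃ₐ[k] Ω) → σ α = α) :
    (d : ℤ) ∣ WithZero.log (w.valuation k a) := by
  classical
  -- ### the finite Galois extension `L = k(α)` and its arithmetic
  set L : IntermediateField k Ω := k⟮α⟯ with hLdef
  have hαint : IsIntegral k α := by
    refine IsIntegral.of_pow hd ?_
    rw [hα]
    exact isIntegral_algebraMap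
  haveI : FiniteDimensional k L := IntermediateField.adjoin.finiteDimensional hαint
  haveI : Normal k L := normal_adjoin_root hd hζ ha hα
  haveI : IsGalois k L := ⟨⟩
  haveI : NumberField L := NumberField.of_module_finite k L
  haveI : Module.Finite (𝓞 k) (𝓞 L) := IsIntegralClosure.finite (𝓞 k) k L (𝓞 L)
  haveI : IsGaloisGroup (L ≃ₐ[k] L) (𝓞 k) (𝓞 L) :=
    IsGaloisGroup.of_isFractionRing (L ≃ₐ[k] L) (𝓞 k) (𝓞 L) k L
  set G := L ≃ₐ[k] L
  let α' : L := AdjoinSimple.gen k α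
  have hα' : (α' : Ω) = α := rfl
  -- ### the prime `P = 𝔓 ∩ 𝓞 L` below `𝔓`
  set ι := ringOfIntegersToIntegralClosure (k := k) (Ω := Ω) L with hιdef
  set P : Ideal (𝓞 L) := 𝔓.comap ι with hPdef
  haveI hPprime : P.IsPrime := Ideal.comap_isPrime ι 𝔓
  haveI hPover : P.LiesOver w.asIdeal := by
    constructor
    change w.asIdeal = Ideal.comap (algebraMap (𝓞 k) (𝓞 L)) (Ideal.comap ι 𝔓)
    rw [Ideal.comap_comap, hιdef, ringOfIntegersToIntegralClosure_comp_algebraMap]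
    exact Ideal.LiesOver.over
  have hPne : P ≠ ⊥ := Ideal.ne_bot_of_liesOver_of_ne_bot w.ne_bot P
  let wP : HeightOneSpectrum (𝓞 L) := ⟨P, hPprime, hPne⟩
  haveI : wP.asIdeal.LiesOver w.asIdeal := hPover
  -- ### Step 1: the inertia group of `P` in `G` is trivial
  have hinertia : P.inertia G = ⊥ := by
    rw [Subgroup.eq_bot_iff_forall]
    intro g hg
    rw [Ideal.inertia, AddSubgroup.mem_inertia] at hg
    -- profinite set-up for `Gal(Ω/k)` acting on `B`
    letI : TopologicalSpace (integralClosure (𝓞 k) Ω) := ⊥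
    haveI : DiscreteTopology (integralClosure (𝓞 k) Ω) := ⟨rfl⟩
    haveI : ContinuousSMul (Ω ≃ₐ[k] Ω) (integralClosure (𝓞 k) Ω) :=
      continuousSMul_iff_stabilizer_isOpen.mpr (Literature.NumberTheory.GaloisRepresentations.stabilizer_integralClosure_isOpen (𝓞 k))
    let N : Subgroup (Ω ≃ₐ[k] Ω) := L.fixingSubgroup
    have hN : IsClosed (N : Set (Ω ≃ₐ[k] Ω)) := IntermediateField.fixingSubgroup_isClosed L
    -- lift `g` to `Ω`
    let g₀ : Ω ≃ₐ[k] Ω := AlgEquiv.liftNormal g Ω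
    have hg₀ : ∀ x : L, g₀ (x : Ω) = (g x : Ω) := fun x ↦ AlgEquiv.liftNormal_commutes g Ω x
    -- `g₀` acts as inertia on the `N`-invariants of `B`
    have hg₀inv : ∀ b : integralClosure (𝓞 k) Ω, (∀ n ∈ N, n • b = b) → g₀ • b - b ∈ 𝔓 := by
      intro b hb
      have hbL : (b : Ω) ∈ L := by
        rw [← InfiniteGalois.fixedField_fixingSubgroup L, IntermediateField.mem_fixedField_iff]
        intro f hf
        have := congrArg Subtype.val (hb f hf)
        rwa [integralClosure.coe_smul] at this
      have hbint : IsIntegral ℤ (⟨(b : Ω), hbL⟩ : L) := by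
        rw [← isIntegral_algebraMap_iff (algebraMap L Ω).injective]
        exact isIntegral_trans (R := ℤ) (A := 𝓞 k) (b : Ω) b.2
      set x : 𝓞 L := ⟨⟨(b : Ω), hbL⟩, hbint⟩ with hxdef
      have hbx : b = ι x := Subtype.ext rfl
      have hgx : g • x - x ∈ P := hg x
      rw [hPdef, Ideal.mem_comap, map_sub] at hgx
      rw [hbx]
      convert hgx using 2
      apply Subtype.ext
      rw [integralClosure.coe_smul, coe_ringOfIntegersToIntegralClosure,
        coe_ringOfIntegersToIntegralClosure]
      exact hg₀ x
    obtain ⟨n, hn, n', hn', hσ⟩ := GaloisRepresentations.exists_mul_mul_mem_inertia N hN 𝔓 g₀ hg₀inv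
    -- the lifted inertia element fixes `α`, hence `g` fixes `α'`
    have h1 : (n * g₀ * n') α = α := hI _ hσ
    have hn'α : n' α = α := (IntermediateField.mem_fixingSubgroup_iff _ _).mp hn' α
      (IntermediateField.mem_adjoin_simple_self k α)
    have hgα : g₀ α = (g α' : Ω) := hg₀ α'
    have hnα : n (g₀ α) = g₀ α := by
      rw [hgα]
      exact (IntermediateField.mem_fixingSubgroup_iff _ _).mp hn _ (g α').2
    rw [AlgEquiv.mul_apply, AlgEquiv.mul_apply, hn'α, hnα, hgα] at h1
    have hgα' : g α' = α' := Subtype.ext h1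
    exact algEquiv_adjoin_eq_one_of_apply_eq g hgα'
  -- ### Step 2: hence `e(P | w) = 1`
  have he : w.asIdeal.ramificationIdx' P = 1 := by
    haveI := w.isPrime
    rw [Ideal.ramificationIdx'_eq_ramificationIdx w.asIdeal P w.ne_bot,
      ← Ideal.ramificationIdxIn_eq_ramificationIdx w.asIdeal P G,
      ← Ideal.card_inertia_eq_ramificationIdxIn (G := G) w.asIdeal P, hinertia, Subgroup.card_bot]
  -- ### Step 3: `ord_w(a) = ord_P(a) = d · ord_P(α)`
  have hval := HeightOneSpectrum.valuation_liesOver L w wP a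
  rw [he, pow_one] at hval
  have haL : algebraMap k L a = α' ^ d := by
    apply (algebraMap L Ω).injective
    rw [map_pow, ← IsScalarTower.algebraMap_apply, ← hα]
    rfl
  rw [hval, haL, map_pow, WithZero.log_pow, nsmul_eq_mul]
  exact Dvd.intro _ rfl

/-- **Specialisation to the absolute Galois group.** `Literature.NumberTheory.EllipticCurves.dvd_log_valuation_of_inertia_fixes_root`
for `Ω = k̄ = AlgebraicClosure k`, in the conventions of `IntegralGaloisAction` /
`SelmerUnramified` / `H1UnramifiedFinite`: `𝔓 ∈ w.primesAbove` a prime of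
`\bar ℤ_k = absIntegers (𝓞 k) k` and the inertia group `I_𝔓 ≤ Field.absoluteGaloisGroup k`
(Mathlib's `Ideal.inertia` for the tree's action of `Gal(k̄/k)` on `\bar ℤ_k`). If every
`σ ∈ I_𝔓` fixes a `d`-th root `α ∈ k̄` of `a ∈ k^*` (`μ_d ⊆ k`), then `d ∣ ord_w(a)`.
Silverman, *AEC*, proof of Prop. VIII.1.6 ("only if" direction of the unramifiedness criterion).
[cite: SilvermanAEC2009, Prop. VIII.1.6 (proof)] -/
theorem dvd_log_valuation_of_absoluteGaloisGroup_inertia_fixes_root {d : ℕ} (hd : 0 < d) {ζ : k}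
    (hζ : IsPrimitiveRoot ζ d) {a : k} (ha : a ≠ 0) {α : AlgebraicClosure k}
    (hα : α ^ d = algebraMap k (AlgebraicClosure k) a) (w : HeightOneSpectrum (𝓞 k))
    {𝔓 : Ideal (GaloisRepresentations.absIntegers (𝓞 k) k)} (h𝔓 : 𝔓 ∈ w.primesAbove)
    (hI : ∀ σ : Field.absoluteGaloisGroup k, σ ∈ 𝔓.inertia (Field.absoluteGaloisGroup k) →
      σ • α = α) :
    (d : ℤ) ∣ WithZero.log (w.valuation k a) :=
  @dvd_log_valuation_of_inertia_fixes_root k _ _ (AlgebraicClosure k) _ _ _ d hd ζ hζ a ha α hα w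
    𝔓 h𝔓.1 h𝔓.2 hI

end NumberField

end Literature.NumberTheory.EllipticCurves
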